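import Literature.Barriers.ABC.BakerMethodBoundsYuInputProofs
import HarnessLib

/-!
# The `p`-adic approximation bound over `ℚ` from a core in SHAPE form — elimination of
# multiplicative relations (dependent `p`-adic units from independent ones)

Topic `NumberTheory/DiophantineGeometry`; namespace `Literature.NumberTheory.DiophantineGeometry.Dioph`.
Proofs only: no definition, no named fact. Companion of `ApproximationBoundRatPadicOfCoreProofs.lean`.

`depCore_of_indepCore`: at a fixed prime `p`, a `p`-adic linear-forms bound in shape form for
multiplicatively INDEPENDENT rational `p`-adic units (the text of the cell `abc-stewartyu`'s Gen-3
internal statement `CoreOdd`/`CoreTwo` with the Kummer hypothesis deleted: weights `h(θₖ) ≤ Aₖ`,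
`1 ≤ Aₖ ≤ Amax`, exponents `n ≠ 0` with `log max(3,|nₖ|) ≤ W`, `1 ≤ W`, conclusion
`ord_p(∏ θₖ^{nₖ} − 1)·log p ≤ C₀^n·(p/log p)·∏ Aₖ·(W + log p + log 2Amax)`; at `p = 2` for units
`≡ 1 (mod 8)`) implies the same kind of bound for DEPENDENT units `αₖ ∉ {0, ±1}` in the additive
log slot `log B + log p + ∑ log(3h(αₖ)) + 2n` with plain heights as weights and constant
`C = (C₀ + 2)/log 2`. Proof: strong induction on the number of `αₖ` (Yu 1999 Lemma 15.1 /
Loxton–van der Poorten pattern, as in the tree's explicit twin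
`Literature.Barriers.ABC.yu2007_padicLogForm_rat_of_core''`): a dependent datum carries a small
relation `∏ αₖ^{2tₖ} = 1`, `|tₖ| ≤ ∏_{l ∈ S∖k} 2h(α_l)/log 2` (`exists_small_mult_relation`), one index
`j ∈ S` is eliminated by `Ξ ↦ Ξ^{2tⱼ}` (`yu2007_dep_transfer`; `ord_p` only grows), the exponents grow
by the factor `2m*` with `log m* ≤ 0.7 + 1.2|S| + ∑_{l∈S} log h(α_l)` (`yu2007_mstar_log_aux`), which
the additive slot absorbs with a factor `2 ≤ C·h(αⱼ)`.

## References

* [Yu1999] K. Yu, *p-adic logarithmic forms and group varieties II*, Acta Arith. 89 (1999) —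
  §15, Lemma 15.1 (p. 378): reduction to multiplicatively independent numbers.
* [EvertseGyory2015] J.-H. Evertse, K. Győry, *Unit Equations in Diophantine Number Theory*,
  CUP 2015 — §4.4.2 (pp. 80–81).
-/

noncomputable section

open Finset Real Height

namespace Literature.NumberTheory.DiophantineGeometry.Dioph

/-! ### Elementary lemmas -/

/-- `(log p)² ≤ 4p` for `p ≥ 1`, in the form `log p ≤ 4 · (p / log p)` (for `p > 1`). [folklore] -/
private theorem log_le_four_mul_div_log {p : ℝ} (hp : 1 < p) : Real.log p ≤ 4 * (p / Real.log p) := by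
  have hp0 : 0 < p := by linarith
  have hlogp : 0 < Real.log p := Real.log_pos hp
  have hs : Real.log (Real.sqrt p) ≤ Real.sqrt p - 1 :=
    Real.log_le_sub_one_of_pos (Real.sqrt_pos.mpr hp0)
  rw [Real.log_sqrt hp0.le] at hs
  have h1 : Real.log p ≤ 2 * Real.sqrt p := by linarith [Real.sqrt_nonneg p]
  have h2 : Real.log p ^ 2 ≤ 4 * p := by
    have h3 : (2 * Real.sqrt p) ^ 2 = 4 * p := by
      rw [mul_pow, Real.sq_sqrt hp0.le]; norm_num
    nlinarith [h1, hlogp]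
  rw [mul_div_assoc', le_div_iff₀ hlogp]
  nlinarith


/-- `1 ≤ ∏_{k ∈ s} A k` when every `A k ≥ 1`. [folklore] -/
private theorem one_le_prod_of_one_le {κ : Type} (s : Finset κ) {A : κ → ℝ} (hA : ∀ k, 1 ≤ A k) :
    1 ≤ ∏ k ∈ s, A k :=
  Finset.prod_induction A (fun x => 1 ≤ x) (fun _ _ ha hb => one_le_mul_of_one_le_of_one_le ha hb)
    le_rfl fun k _ => hA k

/-- `A k ≤ ∏ A` when every `A l ≥ 1`. [folklore] -/
private theorem le_prod_of_one_le {κ : Type} [Fintype κ] [DecidableEq κ] {A : κ → ℝ}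
    (hA : ∀ k, 1 ≤ A k) (k : κ) : A k ≤ ∏ l, A l := by
  rw [← Finset.mul_prod_erase univ A (mem_univ k)]
  have h1 := one_le_prod_of_one_le (univ.erase k) hA
  have h0 : 0 ≤ A k := le_trans zero_le_one (hA k)
  nlinarith

/-! ### The independent case: change of currency -/

/-- **Base of the induction** (independent `αₖ`): the shape bound for independent `p`-adic units
with weights `Aₖ := h(αₖ)/log 2`, `Amax := ∏ Aₖ`, `W := log B` is at most the additive-slot bound
with constant `C ≥ C₀/log 2` (`log Aₖ ≤ log(3h(αₖ))` as `−log log 2 ≤ ½ ≤ log 3`).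
[cite: Yu1999, §15 (p. 378)] -/
theorem depCore_of_indepCore_base {p : ℕ} [hp : Fact p.Prime] {C₀ C : ℝ} (hC₀ : 1 ≤ C₀)
    (hC : C₀ / Real.log 2 ≤ C)
    (hind : ∀ (κ : Type) [Fintype κ] [DecidableEq κ] (θ : κ → ℚ) (n : κ → ℤ) (A : κ → ℝ)
      (Amax W : ℝ),
      (∀ k, θ k ≠ 0 ∧ padicValRat p (θ k) = 0) → (p = 2 → ∀ k, 3 ≤ padicValRat 2 (θ k - 1)) →
      (∀ μ : κ → ℤ, ∏ k, θ k ^ μ k = 1 → μ = 0) →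
      (∀ k, logHeight₁ (θ k) ≤ A k) → (∀ k, 1 ≤ A k) → (∀ k, A k ≤ Amax) →
      n ≠ 0 → (∀ k, Real.log (max 3 (|n k| : ℝ)) ≤ W) → 1 ≤ W →
      (padicValRat p (∏ k, θ k ^ n k - 1) : ℝ) * Real.log p ≤
        C₀ ^ Fintype.card κ * (p / Real.log p) * (∏ k, A k) * (W + Real.log p + Real.log (2 * Amax)))
    {κ : Type} [Fintype κ] [DecidableEq κ] (α : κ → ℚ) (b : κ → ℤ) (B : ℝ)
    (hα : ∀ k, α k ≠ 0) (hunit : ∀ k, padicValRat p (α k) = 0) (hα1 : ∀ k, α k ≠ 1)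
    (hα2 : ∀ k, α k ≠ -1) (h8 : p = 2 → ∀ k, 3 ≤ padicValRat 2 (α k - 1))
    (hB : ∀ k, (|b k| : ℝ) ≤ B) (hB3 : 3 ≤ B) (hne : ∏ k, α k ^ b k ≠ 1)
    (hindep : ∀ μ : κ → ℤ, ∏ k, α k ^ μ k = 1 → μ = 0) :
    (padicValRat p (∏ k, α k ^ b k - 1) : ℝ) * Real.log p ≤
      C ^ Fintype.card κ * (p / Real.log p) * (∏ k, logHeight₁ (α k)) *
        (Real.log B + Real.log p + ∑ k, Real.log (3 * logHeight₁ (α k)) + 2 * Fintype.card κ) := by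
  set n := Fintype.card κ with hn
  set h : κ → ℝ := fun k => logHeight₁ (α k) with hh
  have hl2 : 0 < Real.log 2 := Real.log_pos one_lt_two
  have hl2' : Real.log 2 ≤ 1 := by linarith [Real.log_two_lt_d9]
  have hh2 : ∀ k, Real.log 2 ≤ h k := fun k => log_two_le_logHeight₁ (hα k) (hα1 k) (hα2 k)
  have hhpos : ∀ k, 0 < h k := fun k => lt_of_lt_of_le hl2 (hh2 k)
  have hp1 : (1 : ℝ) < p := by exact_mod_cast hp.out.one_lt
  have hlogp : 0 ≤ Real.log p := (Real.log_pos hp1).le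
  have hpdiv : 0 ≤ (p : ℝ) / Real.log p := div_nonneg (by linarith) hlogp
  -- `n ≥ 1` and `b ≠ 0`
  have hb0 : b ≠ 0 := by
    intro h0; apply hne; simp [h0]
  have hn1 : 1 ≤ n := by
    rw [hn]; by_contra h0; push Not at h0
    have : Fintype.card κ = 0 := by omega
    haveI : IsEmpty κ := Fintype.card_eq_zero_iff.mp this
    exact hb0 (funext fun k => isEmptyElim k)
  -- the currency of the independent core
  set A : κ → ℝ := fun k => h k / Real.log 2 with hA
  have hA1 : ∀ k, 1 ≤ A k := fun k => by rw [hA]; dsimp only; rw [le_div_iff₀ hl2]; linarith [hh2 k]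
  have hAh : ∀ k, logHeight₁ (α k) ≤ A k := fun k => by
    rw [hA]; dsimp only; rw [le_div_iff₀ hl2]; nlinarith [hhpos k]
  have hAmax : ∀ k, A k ≤ ∏ l, A l := le_prod_of_one_le hA1
  have hB0 : 0 < B := by linarith
  have hW : ∀ k, Real.log (max 3 (|b k| : ℝ)) ≤ Real.log B := fun k =>
    Real.log_le_log (lt_max_of_lt_left (by norm_num)) (max_le hB3 (hB k))
  have hW1 : 1 ≤ Real.log B := by
    rw [Real.le_log_iff_exp_le hB0]
    have := Real.exp_one_lt_d9; linarith
  have hmain := hind κ α b A (∏ l, A l) (Real.log B) (fun k => ⟨hα k, hunit k⟩) h8 hindep hAh hA1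
    hAmax hb0 hW hW1
  -- comparison of the two currencies
  have hprodA : ∏ l, A l = (∏ l, h l) / Real.log 2 ^ n := by
    rw [hA]; dsimp only
    rw [Finset.prod_div_distrib, Finset.prod_const, Finset.card_univ]
  have hprodA1 : 1 ≤ ∏ l, A l := one_le_prod_of_one_le univ hA1
  have hlogA : Real.log (2 * ∏ l, A l) ≤ ∑ k, Real.log (3 * h k) + 2 * n := by
    rw [Real.log_mul two_ne_zero (by linarith), Real.log_prod (s := univ) (f := A)
      (fun k _ => by linarith [hA1 k])]
    have hloglog : -(1 / 2 : ℝ) ≤ Real.log (Real.log 2) := by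
      have h := Real.log_le_log (Real.exp_pos _) Literature.Barriers.ABC.exp_neg_half_le_log_two
      rw [Real.log_exp] at h; linarith
    have hlog3 : (1 / 2 : ℝ) ≤ Real.log 3 := by
      rw [Real.le_log_iff_exp_le (by norm_num)]
      have h1 : Real.exp (1 / 2) ^ 2 = Real.exp 1 := by rw [← Real.exp_nat_mul]; norm_num
      nlinarith [Real.exp_one_lt_d9, Real.exp_pos (1 / 2 : ℝ)]
    have hterm : ∀ k, Real.log (A k) ≤ Real.log (3 * h k) := by
      intro k
      rw [hA]; dsimp only
      rw [Real.log_div (hhpos k).ne' hl2.ne', Real.log_mul (by norm_num) (hhpos k).ne']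
      linarith
    have hsum : ∑ k, Real.log (A k) ≤ ∑ k, Real.log (3 * h k) := Finset.sum_le_sum fun k _ => hterm k
    have hn1' : (1 : ℝ) ≤ n := by exact_mod_cast hn1
    linarith [Real.log_two_lt_d9]
  have hslot : Real.log B + Real.log p + Real.log (2 * ∏ l, A l) ≤
      Real.log B + Real.log p + ∑ k, Real.log (3 * h k) + 2 * n := by linarith
  have hslot0 : 0 ≤ Real.log B + Real.log p + Real.log (2 * ∏ l, A l) := by
    have : 0 ≤ Real.log (2 * ∏ l, A l) := Real.log_nonneg (by linarith)
    linarith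
  have hconst : C₀ ^ n * ∏ l, A l ≤ C ^ n * ∏ l, h l := by
    rw [hprodA, show C₀ ^ n * ((∏ l, h l) / Real.log 2 ^ n) = (C₀ / Real.log 2) ^ n * ∏ l, h l by
      rw [div_pow]; field_simp]
    exact mul_le_mul_of_nonneg_right
      (pow_le_pow_left₀ (div_nonneg (by linarith) hl2.le) hC n)
      (Finset.prod_nonneg fun l _ => (hhpos l).le)
  have hA0 : 0 ≤ C₀ ^ n * ∏ l, A l := mul_nonneg (pow_nonneg (by linarith) n) (by linarith)
  calc (padicValRat p (∏ k, α k ^ b k - 1) : ℝ) * Real.log p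
      ≤ C₀ ^ n * (p / Real.log p) * (∏ l, A l) *
          (Real.log B + Real.log p + Real.log (2 * ∏ l, A l)) := hmain
    _ = (p / Real.log p) * ((C₀ ^ n * ∏ l, A l) *
          (Real.log B + Real.log p + Real.log (2 * ∏ l, A l))) := by ring
    _ ≤ (p / Real.log p) * ((C ^ n * ∏ l, h l) *
          (Real.log B + Real.log p + ∑ k, Real.log (3 * h k) + 2 * n)) := by
        apply mul_le_mul_of_nonneg_left _ hpdiv
        exact mul_le_mul hconst hslot hslot0 (le_trans hA0 hconst)
    _ = C ^ n * (p / Real.log p) * (∏ l, h l) *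
          (Real.log B + Real.log p + ∑ k, Real.log (3 * h k) + 2 * n) := by ring


/-! ### The induction: eliminating multiplicative relations -/

set_option maxHeartbeats 400000 in
/-- **Dependent from independent** (`p` fixed): the shape bound for multiplicatively independent
rational `p`-adic units (`hind`, constant `C₀ ≥ 1`, log slot `W + log p + log 2Amax`) implies the
shape bound for arbitrary rational `p`-adic units `αₖ ∉ {0, ±1}` (at `p = 2`: `≡ 1 (mod 8)`) with
plain heights as weights, additive log slot `log B + log p + ∑ₖ log(3h(αₖ)) + 2n` and constant
`(C₀ + 2)/log 2`: strong induction on the number of `αₖ`; a dependent datum carries a small relation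
(`exists_small_mult_relation`), one of whose indices is eliminated (`yu2007_dep_transfer`), the
exponents growing by a factor `2m*` with `log m* ≤ 0.7 + 1.2 n + ∑ log h(αₖ)` — absorbed by the
slot at the price of a factor `2 ≤ C · h(αⱼ)`. [cite: Yu1999, Lemma 15.1 (p. 378)] -/
theorem depCore_of_indepCore {p : ℕ} [hp : Fact p.Prime] {C₀ : ℝ} (hC₀ : 1 ≤ C₀)
    (hind : ∀ (κ : Type) [Fintype κ] [DecidableEq κ] (θ : κ → ℚ) (n : κ → ℤ) (A : κ → ℝ)
      (Amax W : ℝ),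
      (∀ k, θ k ≠ 0 ∧ padicValRat p (θ k) = 0) → (p = 2 → ∀ k, 3 ≤ padicValRat 2 (θ k - 1)) →
      (∀ μ : κ → ℤ, ∏ k, θ k ^ μ k = 1 → μ = 0) →
      (∀ k, logHeight₁ (θ k) ≤ A k) → (∀ k, 1 ≤ A k) → (∀ k, A k ≤ Amax) →
      n ≠ 0 → (∀ k, Real.log (max 3 (|n k| : ℝ)) ≤ W) → 1 ≤ W →
      (padicValRat p (∏ k, θ k ^ n k - 1) : ℝ) * Real.log p ≤
        C₀ ^ Fintype.card κ * (p / Real.log p) * (∏ k, A k) * (W + Real.log p + Real.log (2 * Amax)))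
    (κ : Type) [Fintype κ] [DecidableEq κ] (α : κ → ℚ) (b : κ → ℤ) (B : ℝ)
    (hα : ∀ k, α k ≠ 0) (hunit : ∀ k, padicValRat p (α k) = 0) (hα1 : ∀ k, α k ≠ 1)
    (hα2 : ∀ k, α k ≠ -1) (h8 : p = 2 → ∀ k, 3 ≤ padicValRat 2 (α k - 1))
    (hB : ∀ k, (|b k| : ℝ) ≤ B) (hB3 : 3 ≤ B) (hne : ∏ k, α k ^ b k ≠ 1) :
    (padicValRat p (∏ k, α k ^ b k - 1) : ℝ) * Real.log p ≤
      ((C₀ + 2) / Real.log 2) ^ Fintype.card κ * (p / Real.log p) * (∏ k, logHeight₁ (α k)) *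
        (Real.log B + Real.log p + ∑ k, Real.log (3 * logHeight₁ (α k)) + 2 * Fintype.card κ) := by
  set C : ℝ := (C₀ + 2) / Real.log 2 with hCdef
  have hl2 : 0 < Real.log 2 := Real.log_pos one_lt_two
  have hl2' : Real.log 2 ≤ 1 := by linarith [Real.log_two_lt_d9]
  have hCC₀ : C₀ / Real.log 2 ≤ C := by
    rw [hCdef]; exact div_le_div_of_nonneg_right (by linarith) hl2.le
  have hC2 : 2 ≤ C * Real.log 2 := by
    rw [hCdef, div_mul_cancel₀ _ hl2.ne']; linarith
  have hC0 : 0 ≤ C := by rw [hCdef]; positivity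
  have hp1 : (1 : ℝ) < p := by exact_mod_cast hp.out.one_lt
  have hlogp : 0 < Real.log p := Real.log_pos hp1
  have hpdiv : 0 ≤ (p : ℝ) / Real.log p := div_nonneg (by linarith) hlogp.le
  -- strong induction on the number of `αₖ`
  suffices H : ∀ (n : ℕ) (κ : Type) [Fintype κ] [DecidableEq κ], Fintype.card κ = n →
      ∀ (α : κ → ℚ) (b : κ → ℤ) (B : ℝ),
      (∀ k, α k ≠ 0) → (∀ k, padicValRat p (α k) = 0) → (∀ k, α k ≠ 1) → (∀ k, α k ≠ -1) →
      (p = 2 → ∀ k, 3 ≤ padicValRat 2 (α k - 1)) →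
      (∀ k, (|b k| : ℝ) ≤ B) → 3 ≤ B → ∏ k, α k ^ b k ≠ 1 →
      (padicValRat p (∏ k, α k ^ b k - 1) : ℝ) * Real.log p ≤
        C ^ Fintype.card κ * (p / Real.log p) * (∏ k, logHeight₁ (α k)) *
          (Real.log B + Real.log p + ∑ k, Real.log (3 * logHeight₁ (α k)) +
            2 * Fintype.card κ) by
    exact H _ κ rfl α b B hα hunit hα1 hα2 h8 hB hB3 hne
  intro n
  induction n using Nat.strong_induction_on with
  | _ n IHn =>
  intro κ _ _ hcard α b B hα hunit hα1 hα2 h8 hB hB3 hne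
  set h : κ → ℝ := fun k => logHeight₁ (α k) with hhdef
  have hh2 : ∀ k, Real.log 2 ≤ h k := fun k => log_two_le_logHeight₁ (hα k) (hα1 k) (hα2 k)
  have hhpos : ∀ k, 0 < h k := fun k => lt_of_lt_of_le hl2 (hh2 k)
  have hB0 : 0 < B := by linarith
  have hlogB : 0 ≤ Real.log B := Real.log_nonneg (by linarith)
  have hlog3h : ∀ k, 0 ≤ Real.log (3 * h k) := fun k =>
    Real.log_nonneg (by linarith [hh2 k, Real.log_two_gt_d9])
  set U := ∑ k, Real.log (3 * h k) with hU
  have hU0 : 0 ≤ U := Finset.sum_nonneg fun k _ => hlog3h k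
  -- `n ≥ 1`
  have hb0 : b ≠ 0 := by intro h0; apply hne; simp [h0]
  have hn1 : 1 ≤ n := by
    by_contra h0; push Not at h0
    have : Fintype.card κ = 0 := by omega
    haveI : IsEmpty κ := Fintype.card_eq_zero_iff.mp this
    exact hb0 (funext fun k => isEmptyElim k)
  by_cases hindep : ∀ μ : κ → ℤ, ∏ k, α k ^ μ k = 1 → μ = 0
  · exact depCore_of_indepCore_base hC₀ hCC₀ hind α b B hα hunit hα1 hα2 h8 hB hB3 hne hindep
  -- a small relation
  push Not at hindep
  obtain ⟨μ, hμrel, hμ0⟩ := hindep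
  obtain ⟨S, t, hSne, hsupp, htrel, hbd⟩ := exists_small_mult_relation hα hμ0 hμrel
  obtain ⟨j, hjS⟩ := hSne
  set r : κ → ℤ := fun k => 2 * t k with hrdef
  have htj : t j ≠ 0 := (hsupp j).mpr hjS
  have hrj : r j ≠ 0 := mul_ne_zero two_ne_zero htj
  have hΛ : ∏ k, α k ^ b k - 1 ≠ 0 := sub_ne_zero.mpr hne
  -- the right-hand side is at least `4 p / log p ≥ log p`
  have hprodh : Real.log 2 ^ n ≤ ∏ k, h k := by
    have : ∏ _i : κ, Real.log 2 = Real.log 2 ^ n := by rw [Finset.prod_const, Finset.card_univ, hcard]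
    rw [← this]
    exact Finset.prod_le_prod (fun i _ => hl2.le) fun i _ => hh2 i
  have hprodh0 : 0 < ∏ k, h k := lt_of_lt_of_le (pow_pos hl2 n) hprodh
  have hCn : 2 ≤ C ^ n * ∏ k, h k := by
    have h1 : (2 : ℝ) ≤ (C * Real.log 2) ^ n := by
      calc (2 : ℝ) = 2 ^ 1 := by norm_num
        _ ≤ 2 ^ n := pow_le_pow_right₀ (by norm_num) hn1
        _ ≤ (C * Real.log 2) ^ n := pow_le_pow_left₀ (by norm_num) hC2 n
    calc (2 : ℝ) ≤ (C * Real.log 2) ^ n := h1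
      _ = C ^ n * Real.log 2 ^ n := mul_pow _ _ _
      _ ≤ C ^ n * ∏ k, h k := mul_le_mul_of_nonneg_left hprodh (pow_nonneg hC0 n)
  have hslot2 : 2 ≤ Real.log B + Real.log p + U + 2 * n := by
    have : (1 : ℝ) ≤ n := by exact_mod_cast hn1
    linarith
  rcases Literature.Barriers.ABC.yu2007_dep_transfer hα hunit b (r := r) htrel hrj hΛ with hv1 | ⟨hΞ'ne, hvle⟩
  · -- `ord_p Λ ≤ 1`
    have h1 : (padicValRat p (∏ k, α k ^ b k - 1) : ℝ) * Real.log p ≤ Real.log p := by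
      have : (padicValRat p (∏ k, α k ^ b k - 1) : ℝ) ≤ 1 := by exact_mod_cast hv1
      nlinarith
    have h2 := log_le_four_mul_div_log hp1
    rw [hcard]
    calc (padicValRat p (∏ k, α k ^ b k - 1) : ℝ) * Real.log p ≤ 4 * (p / Real.log p) := h1.trans h2
      _ = 2 * (p / Real.log p) * 2 := by ring
      _ ≤ (C ^ n * ∏ k, h k) * (p / Real.log p) * (Real.log B + Real.log p + U + 2 * n) :=
          mul_le_mul (mul_le_mul_of_nonneg_right hCn hpdiv) hslot2 zero_le_two (by positivity)
      _ = C ^ n * (p / Real.log p) * (∏ k, h k) * (Real.log B + Real.log p + U + 2 * n) := by ring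
  -- elimination of the index `j`
  set b' : κ → ℤ := fun k => r j * b k - r k * b j with hb'def
  -- the size `ms` of the relation
  set c : κ → ℝ := fun l => 2 * logHeight₁ (α l) / Real.log 2 with hc
  set ms : ℝ := 2 * ∏ l ∈ S, c l with hms
  have hc2 : ∀ l, 2 ≤ c l := fun l => by
    rw [hc]; dsimp only; rw [le_div_iff₀ hl2]; linarith [hh2 l]
  have hc0 : ∀ l, 0 < c l := fun l => lt_of_lt_of_le two_pos (hc2 l)
  have hP1 : 1 ≤ ∏ l ∈ S, c l := one_le_prod_of_one_le S fun l => le_trans one_le_two (hc2 l)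
  have hms2 : 2 ≤ ms := by rw [hms]; linarith
  have habsr : ∀ k, |(r k : ℝ)| ≤ ms := by
    intro k
    rw [hrdef]; dsimp only; push_cast
    by_cases hk : k ∈ S
    · have h1 := hbd k hk
      have h2 : (∏ l ∈ S.erase k, c l) ≤ ∏ l ∈ S, c l := by
        rw [← Finset.mul_prod_erase S c hk]
        have h0 : 0 ≤ ∏ l ∈ S.erase k, c l := Finset.prod_nonneg fun l _ => (hc0 l).le
        nlinarith [hc2 k]
      rw [abs_mul, abs_two, hms]
      linarith
    · have : t k = 0 := by by_contra h0; exact hk ((hsupp k).mp h0)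
      rw [this]; simp; linarith
  have hlogms : Real.log ms ≤ 0.7 + 1.2 * S.card + ∑ l ∈ S, Real.log (logHeight₁ (α l)) :=
    Literature.Barriers.ABC.yu2007_mstar_log_aux hh2 hc hms
  -- new exponents bounded by `B' = 2 ms B ≥ 3`
  have hms0 : 0 < ms := by linarith
  have hB' : ∀ k : {k // k ≠ j}, |((b' k.val : ℤ) : ℝ)| ≤ 2 * ms * B := by
    intro k
    rw [hb'def]; dsimp only; push_cast
    have h5 : |(r j : ℝ) * (b k.val : ℝ)| ≤ ms * B := by
      rw [abs_mul]; exact mul_le_mul (habsr j) (hB k.val) (abs_nonneg _) hms0.le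
    have h6 : |(r k.val : ℝ) * (b j : ℝ)| ≤ ms * B := by
      rw [abs_mul]; exact mul_le_mul (habsr k.val) (hB j) (abs_nonneg _) hms0.le
    calc |(r j : ℝ) * (b k.val : ℝ) - (r k.val : ℝ) * (b j : ℝ)|
        ≤ |(r j : ℝ) * (b k.val : ℝ)| + |(r k.val : ℝ) * (b j : ℝ)| := abs_sub _ _
      _ ≤ 2 * ms * B := by linarith
  have hB'3 : 3 ≤ 2 * ms * B := by nlinarith
  -- the datum on `{k // k ≠ j}`
  obtain ⟨m, hm⟩ : ∃ m, n = m + 1 := ⟨n - 1, by omega⟩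
  have hcard' : Fintype.card {k // k ≠ j} = m := by
    rw [Fintype.card_of_subtype (univ.erase j) (fun k => by simp), Finset.card_erase_of_mem
      (mem_univ j), card_univ, hcard, hm]; simp
  have hprod' : ∏ k : {k // k ≠ j}, α k.val ^ b' k.val = ∏ k ∈ univ.erase j, α k ^ b' k :=
    (Finset.prod_subtype (univ.erase j) (fun k => by simp) (fun k => α k ^ b' k)).symm
  have hΛ' : ∏ k : {k // k ≠ j}, α k.val ^ b' k.val ≠ 1 := by
    rw [hprod']; intro h0; exact hΞ'ne (by rw [h0, sub_self])
  have hIH := IHn m (by omega) {k // k ≠ j} hcard' (fun k => α k.val) (fun k => b' k.val)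
    (2 * ms * B) (fun k => hα k.val) (fun k => hunit k.val) (fun k => hα1 k.val)
    (fun k => hα2 k.val) (fun h2 k => h8 h2 k.val) hB' hB'3 hΛ'
  rw [hcard', hprod'] at hIH
  have hHj : ∏ k : {k // k ≠ j}, h k.val = ∏ k ∈ univ.erase j, h k :=
    (Finset.prod_subtype (univ.erase j) (fun k => by simp) (fun k => h k)).symm
  have hUj : ∑ k : {k // k ≠ j}, Real.log (3 * h k.val) = ∑ k ∈ univ.erase j, Real.log (3 * h k) :=
    (Finset.sum_subtype (univ.erase j) (fun k => by simp) (fun k => Real.log (3 * h k))).symm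
  have hHj' : ∏ k : {k // k ≠ j}, logHeight₁ (α k.val) = ∏ k ∈ univ.erase j, h k := hHj
  have hUj' : ∑ k : {k // k ≠ j}, Real.log (3 * logHeight₁ (α k.val)) =
      ∑ k ∈ univ.erase j, Real.log (3 * h k) := hUj
  rw [hHj', hUj'] at hIH
  -- arithmetic of the step
  set Hj := ∏ k ∈ univ.erase j, h k with hHjdef
  set Uj := ∑ k ∈ univ.erase j, Real.log (3 * h k) with hUjdef
  have hHj0 : 0 ≤ Hj := Finset.prod_nonneg fun k _ => (hhpos k).le
  have hUjU : Uj ≤ U := Finset.sum_le_sum_of_subset_of_nonneg (Finset.erase_subset j univ)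
    fun k _ _ => hlog3h k
  have hSU : ∑ l ∈ S, Real.log (logHeight₁ (α l)) ≤ U := by
    have h1 : ∑ l ∈ S, Real.log (logHeight₁ (α l)) ≤ ∑ l ∈ S, Real.log (3 * h l) := by
      apply Finset.sum_le_sum; intro l _
      exact Real.log_le_log (hhpos l) (by linarith [hhpos l])
    exact h1.trans (Finset.sum_le_sum_of_subset_of_nonneg (Finset.subset_univ S)
      fun k _ _ => hlog3h k)
  have hScard : (S.card : ℝ) ≤ n := by rw [← hcard]; exact_mod_cast Finset.card_le_univ S
  have hlogB' : Real.log (2 * ms * B) = Real.log 2 + Real.log ms + Real.log B := by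
    rw [Real.log_mul (by positivity) hB0.ne', Real.log_mul two_ne_zero hms0.ne']
  have hmR : (m : ℝ) + 1 = n := by rw [hm]; push_cast; ring
  have hslot' : Real.log (2 * ms * B) + Real.log p + Uj + 2 * (m : ℝ) ≤
      2 * (Real.log B + Real.log p + U + 2 * n) := by
    rw [hlogB']
    have := Real.log_two_lt_d9
    linarith [hlogms, hSU, hUjU, hScard, hmR, hlogB, hlogp.le, hU0]
  have hslot'0 : 0 ≤ Real.log (2 * ms * B) + Real.log p + Uj + 2 * (m : ℝ) := by
    have h1 : 0 ≤ Real.log (2 * ms * B) := Real.log_nonneg (by linarith)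
    have h2 : 0 ≤ Uj := Finset.sum_nonneg fun k _ => hlog3h k
    positivity
  -- `2 C^m Hj ≤ C^(m+1) ∏ h` since `C h(αⱼ) ≥ C log 2 ≥ 2`
  have hprodsplit : ∏ k, h k = h j * Hj := (Finset.mul_prod_erase univ h (mem_univ j)).symm
  have hCm : 2 * (C ^ m * Hj) ≤ C ^ n * ∏ k, h k := by
    rw [hprodsplit, hm, pow_succ]
    have h1 : 2 ≤ C * h j := le_trans hC2 (mul_le_mul_of_nonneg_left (hh2 j) hC0)
    have h2 : 0 ≤ C ^ m * Hj := mul_nonneg (pow_nonneg hC0 m) hHj0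
    calc 2 * (C ^ m * Hj) ≤ (C * h j) * (C ^ m * Hj) := mul_le_mul_of_nonneg_right h1 h2
      _ = C ^ m * C * (h j * Hj) := by ring
  have hvle' : (padicValRat p (∏ k, α k ^ b k - 1) : ℝ) * Real.log p ≤
      (padicValRat p (∏ k ∈ univ.erase j, α k ^ b' k - 1) : ℝ) * Real.log p :=
    mul_le_mul_of_nonneg_right (by exact_mod_cast hvle) hlogp.le
  rw [hcard]
  calc (padicValRat p (∏ k, α k ^ b k - 1) : ℝ) * Real.log p
      ≤ (padicValRat p (∏ k ∈ univ.erase j, α k ^ b' k - 1) : ℝ) * Real.log p := hvle'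
    _ ≤ C ^ m * (p / Real.log p) * Hj *
        (Real.log (2 * ms * B) + Real.log p + Uj + 2 * (m : ℝ)) := by exact_mod_cast hIH
    _ = (p / Real.log p) * ((C ^ m * Hj) *
        (Real.log (2 * ms * B) + Real.log p + Uj + 2 * (m : ℝ))) := by ring
    _ ≤ (p / Real.log p) * ((C ^ m * Hj) * (2 * (Real.log B + Real.log p + U + 2 * n))) := by
        apply mul_le_mul_of_nonneg_left _ hpdiv
        exact mul_le_mul_of_nonneg_left hslot' (mul_nonneg (pow_nonneg hC0 m) hHj0)
    _ = (p / Real.log p) * ((2 * (C ^ m * Hj)) * (Real.log B + Real.log p + U + 2 * n)) := by ring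
    _ ≤ (p / Real.log p) * ((C ^ n * ∏ k, h k) * (Real.log B + Real.log p + U + 2 * n)) := by
        apply mul_le_mul_of_nonneg_left _ hpdiv
        exact mul_le_mul_of_nonneg_right hCm (by linarith)
    _ = C ^ n * (p / Real.log p) * (∏ k, h k) * (Real.log B + Real.log p + U + 2 * n) := by ring

end Literature.NumberTheory.DiophantineGeometry.Dioph

end
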